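import Summits.ResolutionOfSingularities.ResolutionOfSingularities.Theorems.FrobeniusClosingPatchingRelPerfectDepthGradedRetraction
import Literature.AlgebraicGeometry.Motives.SecOfForm
import HarnessLib

/-!
# Crux `PatchingRelPerfect` (stmt-ResolutionOfSingularities-16161), chain w52 — R4 X-side, graded initial
# state (D): the graded presentation and the retraction `r₀` are morphisms OVER THE BASE

[OURS · L1 W5.2 · rung tool] Companion of `…DepthGradedRetraction.lean` (res-D-pv-055; plan-1 g6 RATIFY
2026-08-27 «(D) initial retraction + graded format over a coefficient field — GO»).  For `y = (y₀, …, y_m)`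
in a ring `S`, `𝔪 = (y)`, `X₁ = Bl_𝔪 Spec S = Proj S[𝔪t]` (`affineBlowup`, `g = affineBlowup.π`), and a
field `κ₀` with `κ₀ → S`, PROVED (chart check on the cover `D₊(P(y)tᵈ)` of Mathlib's `Proj.mapAffineOpenCover`):

* `projMap_reesPresentation_comp_projToSpec` — **`Proj.map (T_j ↦ y_j t) ≫ (ℙᵐ_S → Spec S) = g`**: the
  graded presentation `X₁ → ℙᵐ_S` (tree `reesPresentation`) is a morphism over `Spec S` (on a chart both
  sides are `Spec` of `a ↦ a/1`, tree `awayι_comp_π`, `awayMap_reesPresentation_algebraMap`);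
* `retraction₀_comp_projToSpec` — **`r₀ ≫ (ℙᵐ_{κ₀} → Spec κ₀) = g ≫ (Spec S → Spec κ₀)`** for
  `r₀ = (X₁ → ℙᵐ_S → ℙᵐ_{κ₀})`: the retraction of `…DepthGradedRetraction` is a `κ₀`-morphism — the
  hypothesis `hr` under which the Motives library's generating-sections data `GeneratingSections.ofHom r₀`
  computes the chart values of forms (`sectionsFun_ofHom_eq`), i.e. the input of the graded FORMAT.

Mathlib keeps the standard grading `MvPolynomial.gradedAlgebra` a `def`, whence the `letI`s in the
statements.  Nothing here is a statement of the manuscript under review.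

## References

* U. Görtz, T. Wedhorn, *Algebraic Geometry I*, 2nd ed. (2020), (13.9), Def. 13.90. [GortzWedhorn2020]
* R. Hartshorne, *Algebraic Geometry* (1977), II Thm. 7.1 (a). [Hartshorne1977]
-/

-- `Summit.<Summit>.<Sub>.Theorems` with `Sub = Summit` (single-conjunct summit, D-0017)

set_option linter.dupNamespace false

noncomputable section

open CategoryTheory CategoryTheory.Limits AlgebraicGeometry Literature.AlgebraicGeometry.Resolution
open IsLocalRing TopologicalSpace HomogeneousLocalization
open Literature.AlgebraicGeometry.Motives Literature.AlgebraicGeometry.Motives.ProjBaseChangeRing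

namespace Summit.ResolutionOfSingularities.ResolutionOfSingularities.Theorems

namespace DepthOne

universe u

section StructureMaps

variable {S : Type u} [CommRing S] {m : ℕ} (y : Fin (m + 1) → S)
  (κ₀ : Type u) [Field κ₀] [Algebra κ₀ S]

local notation3 "M" => Ideal.span (Set.range y)
local notation3 "X₁" => affineBlowup (Ideal.span (Set.range y))
local notation3 "g" => affineBlowup.π (Ideal.span (Set.range y))

/-- **The graded presentation `X₁ = Proj S[𝔪t] → ℙᵐ_S` is a morphism over `Spec S`**:
`Proj.map (T_j ↦ y_j t) ≫ (ℙᵐ_S → Spec S) = (X₁ → Spec S)` (checked on the charts `D₊(P(y) tᵈ)`: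
both sides are `Spec` of `a ↦ a/1`). [cite: GortzWedhorn2020, (13.9)] -/
theorem projMap_reesPresentation_comp_projToSpec :
    letI : GradedRing (MvPolynomial.homogeneousSubmodule (Fin (m + 1)) S) := MvPolynomial.gradedAlgebra
    Proj.map (reesPresentation y) (irrelevant_le_map_reesPresentation y) ≫
      projToSpec (Fin (m + 1)) S = g := by
  letI : GradedRing (MvPolynomial.homogeneousSubmodule (Fin (m + 1)) S) := MvPolynomial.gradedAlgebra
  -- the `S`-algebra structures of the homogeneous localisations (Motives `ProjBaseChange.algebraBase`)
  letI : ∀ x : Submonoid (MvPolynomial (Fin (m + 1)) S),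
      Algebra S (HomogeneousLocalization (MvPolynomial.homogeneousSubmodule (Fin (m + 1)) S) x) :=
    fun x => Literature.AlgebraicGeometry.Motives.ProjBaseChange.algebraBase
      (MvPolynomial.homogeneousSubmodule (Fin (m + 1)) S) x
  refine (Proj.mapAffineOpenCover _ (irrelevant_le_map_reesPresentation y)).openCover.hom_ext _ _
    fun s₀ ↦ ?_
  obtain ⟨⟨i, hi⟩, ⟨s, hs⟩⟩ := s₀
  have h1 := Proj.awayι_comp_map (reesPresentation y) (irrelevant_le_map_reesPresentation y) hi s hs
  have h2 := awayι_projToSpec (Fin (m + 1)) (R := S) hs hi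
  have h3 := awayι_comp_π y ((reesPresentation y) s) ((reesPresentation y).2 hs) hi
  have h4 : CommRingCat.ofHom (algebraMap S (Away (MvPolynomial.homogeneousSubmodule (Fin (m + 1)) S) s)) ≫
      CommRingCat.ofHom (Away.map (reesPresentation y) s) =
      CommRingCat.ofHom (reesAwayBase y ((reesPresentation y) s)) := by
    rw [← CommRingCat.ofHom_comp]
    congr 1
    exact RingHom.ext fun a => awayMap_reesPresentation_algebraMap y s a
  simp only [Scheme.AffineOpenCover.openCover_f, Proj.mapAffineOpenCover_f]
  exact ((Category.assoc _ _ _).symm.trans (congrArg (· ≫ projToSpec (Fin (m + 1)) S) h1)).trans <|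
    (Category.assoc _ _ _).trans <|
    (congrArg (Spec.map (CommRingCat.ofHom (Away.map (reesPresentation y) s)) ≫ ·) h2).trans <|
    (Spec.map_comp _ _).symm.trans <| (congrArg Spec.map h4).trans h3.symm

/-- **`r₀ : X₁ → ℙᵐ_{κ₀}` is a morphism over `Spec κ₀`**: `r₀ ≫ (ℙᵐ_{κ₀} → Spec κ₀) =
(X₁ → Spec S → Spec κ₀)`. [cite: GortzWedhorn2020, (13.9)] [cite: Hartshorne1977, II Thm. 7.1 (a)] -/
theorem retraction₀_comp_projToSpec :
    letI : GradedRing (MvPolynomial.homogeneousSubmodule (Fin (m + 1)) S) := MvPolynomial.gradedAlgebra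
    letI : GradedRing (MvPolynomial.homogeneousSubmodule (Fin (m + 1)) κ₀) := MvPolynomial.gradedAlgebra
    (Proj.map (reesPresentation y) (irrelevant_le_map_reesPresentation y) ≫
      Proj.map (mapGraded κ₀ S (Fin (m + 1))) (irrelevant_le_map κ₀ S (Fin (m + 1)))) ≫
      projToSpec (Fin (m + 1)) κ₀ = g ≫ Spec.map (CommRingCat.ofHom (algebraMap κ₀ S)) := by
  letI : GradedRing (MvPolynomial.homogeneousSubmodule (Fin (m + 1)) S) := MvPolynomial.gradedAlgebra
  letI : GradedRing (MvPolynomial.homogeneousSubmodule (Fin (m + 1)) κ₀) := MvPolynomial.gradedAlgebra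
  rw [Category.assoc, (isPullback_projMap' κ₀ S (n := m)).w, ← Category.assoc,
    projMap_reesPresentation_comp_projToSpec y]

end StructureMaps

end DepthOne

end Summit.ResolutionOfSingularities.ResolutionOfSingularities.Theorems

end
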